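import Literature.Claims.NS.Haitani2025
import Summits.NavierStokesRegularity.NavierStokesRegularity.Theorems.SoloRefuteHaitani2025B0Spline
import HarnessLib

/-!
# C133 `Haitani2025` — B₀, file F2: the vector fields `ψ_a` (pointwise calculus)

Towards the case-(α) ADDENDUM `¬ Step1_Display13 B₀` to ADJUDICATED #115 (locator
`Literature.Claims.NS.Haitani2025.Step1_Display13` = display (13) p.4, class unfilled gap; UG CONFIRMED and the B₀
build COMMISSIONED by the chair 2026-08-27T05:18:12Z; design refuter-8 g2, claims/Haitani2025/UG-AUDIT-C133-refuter8g2.md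
and B0/PLAN.md; chain F1a → F1b → F1c (refuter-8 g2) → F2 → F3 (refuter-6 g2) → F4 (refuter-8 g2)).
Over F1a (the clamped two-piece degree-6 `C¹` mother spline `sp`, `dsp = sp′`, rescalings `spS k j x = sp (2^k x − j)`):
for an index `a = (k, j) ∈ Idx` the field
  `ψ_a(x) = amp_k · φ_a(x) · e₀`,  `φ_a(x) = ∏ᵢ sp(2^k xᵢ − jᵢ)`,  `amp_k = (√(30030·2^k))³`,  `e₀ = (1,0,0)`,
and, purely pointwise (nothing is integrated here):
* Definition 1 item 1 (`tsupport_psi`), item 2 (`psi_boundary`), the regularity field (`contDiff_psi`);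
* `Dψ_a` (`hasFDerivAt_psi`, `fderiv_psi_apply`) and the tensor-product shapes that F3 feeds to Fubini on `Ω`:
  `norm_psi_sq`, `inner_psi_psi`, `gradSq_psi` with `dtens_sq`, `convect_psi`, `inner_psi_convect` with `tens_dtens_tens`.
F3 (`SoloRefuteHaitani2025B0System.lean`) integrates and assembles `B0 : WaveletSystem`; F4 evaluates (13) on a parent/child pair.
[cite: Haitani2025NavierStokesGitHub, Definition 1 p.2; (13) p.4]

WHAT THIS IS NOT: not a claim about NS regularity or blow-up; not a claim about any author beyond the typed locator.
-/

set_option linter.dupNamespace false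

open Set Function MeasureTheory
open scoped Topology InnerProductSpace RealInnerProductSpace

namespace Summit.NavierStokesRegularity.NavierStokesRegularity.Theorems.Haitani2025.B0

open Literature.Claims.NS.Haitani2025 Literature.Analysis.FluidPDE
open Literature.Claims.NS.Chio2026 (E3 gradSq)

noncomputable section
/-! ### The fields `ψ_a = amp_k · (⊗ spS) · e₀` -/

/-- The amplitude `(√(30030·2^k))³` normalising `‖ψ_{k,j}‖_{L²(Ω)} = 1`. [folklore] -/
def amp (k : ℕ) : ℝ := Real.sqrt (30030 * 2 ^ k) ^ 3

/-- `amp k > 0`. [folklore] -/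
theorem amp_pos (k : ℕ) : 0 < amp k := by
  unfold amp; positivity

/-- `amp k ² = (30030·2^k)³`. [folklore] -/
theorem amp_sq (k : ℕ) : amp k ^ 2 = (30030 * 2 ^ k) ^ 3 := by
  unfold amp
  rw [← pow_mul, show 3 * 2 = 2 * 3 from rfl, pow_mul, Real.sq_sqrt (by positivity)]

/-- The fixed direction `e₀ = (1,0,0)` of all the fields. [folklore] -/
def e0 : E3 := EuclideanSpace.single 0 1

/-- `‖e₀‖ = 1`. [folklore] -/
theorem norm_e0 : ‖e0‖ = 1 := by
  simp [e0]

/-- `⟪e₀, e₀⟫ = 1`. [folklore] -/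
theorem inner_e0_e0 : ⟪e0, e0⟫_ℝ = 1 := by
  rw [real_inner_self_eq_norm_sq, norm_e0, one_pow]

/-- coordinates of `e₀`. [folklore] -/
theorem e0_apply (i : Fin 3) : e0 i = if i = 0 then 1 else 0 := by
  simp [e0]

/-- The scalar tensor `φ_a(x) = ∏ᵢ sp(2^k xᵢ − jᵢ)`. [folklore] -/
def tens (a : Idx) (x : E3) : ℝ := ∏ i, spS a.1 (a.2 i) (x i)

/-- Its `i`-th partial derivative `∂ᵢφ_a(x) = (∏_{l ≠ i} sp(2^k x_l − j_l)) · 2^k sp′(2^k xᵢ − jᵢ)`. [folklore] -/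
def dtens (a : Idx) (i : Fin 3) (x : E3) : ℝ :=
  (∏ l ∈ Finset.univ.erase i, spS a.1 (a.2 l) (x l)) * (2 ^ a.1 * dspS a.1 (a.2 i) (x i))

/-- **The field `ψ_a = amp_k · φ_a · e₀`** (level `k = a.1`, position `j = a.2`). [folklore] -/
def psi (a : Idx) (x : E3) : E3 := (amp a.1 * tens a x) • e0

/-- coordinates of `ψ_a(x)`: only the first is non-zero. [folklore] -/
theorem psi_apply (a : Idx) (x : E3) (i : Fin 3) :
    psi a x i = if i = 0 then amp a.1 * tens a x else 0 := by
  simp [psi, e0_apply]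

/-! #### support -/

/-- `φ_a(x) = 0` as soon as one coordinate leaves the open dyadic interval. [folklore] -/
theorem tens_eq_zero {a : Idx} {x : E3} (i : Fin 3)
    (h : x i ≤ ((a.2 i : ℕ) : ℝ) / 2 ^ a.1 ∨ (((a.2 i : ℕ) : ℝ) + 1) / 2 ^ a.1 ≤ x i) : tens a x = 0 :=
  Finset.prod_eq_zero (Finset.mem_univ i) (h.elim spS_eq_zero_of_le spS_eq_zero_of_ge)

/-- `∂ᵢφ_a(x) = 0` as soon as one coordinate leaves the open dyadic interval. [folklore] -/
theorem dtens_eq_zero {a : Idx} {x : E3} (i l : Fin 3)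
    (h : x l ≤ ((a.2 l : ℕ) : ℝ) / 2 ^ a.1 ∨ (((a.2 l : ℕ) : ℝ) + 1) / 2 ^ a.1 ≤ x l) : dtens a i x = 0 := by
  unfold dtens
  by_cases hli : l = i
  · subst hli
    rw [h.elim dspS_eq_zero_of_le dspS_eq_zero_of_ge, mul_zero, mul_zero]
  · rw [Finset.prod_eq_zero (Finset.mem_erase.mpr ⟨hli, Finset.mem_univ l⟩)
      (h.elim spS_eq_zero_of_le spS_eq_zero_of_ge), zero_mul]

/-- Outside the open unit cube some coordinate leaves `(0,1)`, hence leaves every dyadic interval. [folklore] -/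
theorem exists_coord_of_not_mem_HOmega (a : Idx) {x : E3} (hx : x ∉ HOmega) :
    ∃ i : Fin 3, x i ≤ ((a.2 i : ℕ) : ℝ) / 2 ^ a.1 ∨ (((a.2 i : ℕ) : ℝ) + 1) / 2 ^ a.1 ≤ x i := by
  simp only [HOmega, mem_setOf_eq, not_forall, mem_Ioo, not_and_or, not_lt] at hx
  obtain ⟨i, hi⟩ := hx
  refine ⟨i, hi.imp (fun h => h.trans (by positivity)) (fun h => le_trans ?_ h)⟩
  rw [div_le_one (by positivity)]
  exact_mod_cast Nat.succ_le_of_lt (a.2 i).isLt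

/-- `ψ_a = 0` off the open unit cube. [folklore] -/
theorem psi_eq_zero_of_not_mem {a : Idx} {x : E3} (hx : x ∉ HOmega) : psi a x = 0 := by
  obtain ⟨i, hi⟩ := exists_coord_of_not_mem_HOmega a hx
  simp [psi, tens_eq_zero i hi]

/-- The open unit cube is open. [folklore] -/
theorem isOpen_HOmega : IsOpen HOmega := by
  have h : HOmega = ⋂ i : Fin 3, (fun x : E3 => x i) ⁻¹' Ioo (0 : ℝ) 1 := by
    ext x
    simp [HOmega]
  rw [h]
  exact isOpen_iInter_of_finite fun i =>
    isOpen_Ioo.preimage (EuclideanSpace.proj i : E3 →L[ℝ] ℝ).continuous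

/-- The closed dyadic cube is closed. [folklore] -/
theorem isClosed_cube (a : Idx) : IsClosed (cube a) := by
  have h : cube a = ⋂ i : Fin 3, (fun x : E3 => x i) ⁻¹'
      Icc (((a.2 i : ℕ) : ℝ) / 2 ^ a.1) ((((a.2 i : ℕ) : ℝ) + 1) / 2 ^ a.1) := by
    ext x
    simp [cube]
  rw [h]
  exact isClosed_iInter fun i =>
    isClosed_Icc.preimage (EuclideanSpace.proj i : E3 →L[ℝ] ℝ).continuous

/-- Definition 1 item 1: `supp ψ_a ⊆` the closed dyadic cube of `a`. [folklore] -/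
theorem tsupport_psi (a : Idx) : tsupport (psi a) ⊆ cube a := by
  refine closure_minimal (fun x hx => ?_) (isClosed_cube a)
  rw [mem_support] at hx
  intro i
  by_contra h
  rw [not_and_or, not_le, not_le] at h
  exact hx (by simp [psi, tens_eq_zero i (h.imp le_of_lt le_of_lt)])

/-- Definition 1 item 2: `ψ_a = 0` on `∂Ω`. [folklore] -/
theorem psi_boundary (a : Idx) (x : E3) (hx : x ∈ frontier HOmega) : psi a x = 0 := by
  rw [isOpen_HOmega.frontier_eq] at hx
  exact psi_eq_zero_of_not_mem hx.2

/-! #### regularity and derivatives -/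

/-- the coordinate factor `x ↦ sp(2^k xᵢ − j)` has derivative `2^k sp′(2^k xᵢ − j) · dxᵢ`. [folklore] -/
theorem hasFDerivAt_coord (k j : ℕ) (i : Fin 3) (x : E3) :
    HasFDerivAt (fun y : E3 => spS k j (y i))
      ((2 ^ k * dspS k j (x i)) • (EuclideanSpace.proj i : E3 →L[ℝ] ℝ)) x := by
  have h := (hasDerivAt_spS k j (x i)).comp_hasFDerivAt x
    (EuclideanSpace.proj i : E3 →L[ℝ] ℝ).hasFDerivAt
  exact h

/-- `Dφ_a(x) = Σᵢ ∂ᵢφ_a(x) dxᵢ`. [folklore] -/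
theorem hasFDerivAt_tens (a : Idx) (x : E3) :
    HasFDerivAt (tens a) (∑ i, dtens a i x • (EuclideanSpace.proj i : E3 →L[ℝ] ℝ)) x := by
  have h := HasFDerivAt.finsetProd (u := Finset.univ)
    (fun i _ => hasFDerivAt_coord a.1 (a.2 i) i x)
  simp only [smul_smul] at h
  exact h

/-- `φ_a ∈ C¹`. [folklore] -/
theorem contDiff_tens (a : Idx) : ContDiff ℝ 1 (tens a) :=
  contDiff_prod (t := Finset.univ)
    (fun i _ => (contDiff_spS a.1 (a.2 i)).comp (EuclideanSpace.proj i : E3 →L[ℝ] ℝ).contDiff)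

/-- `φ_a` is continuous. [folklore] -/
theorem continuous_tens (a : Idx) : Continuous (tens a) := (contDiff_tens a).continuous

/-- `∂ᵢφ_a` is continuous. [folklore] -/
theorem continuous_dtens (a : Idx) (i : Fin 3) : Continuous (dtens a i) := by
  unfold dtens
  refine (continuous_finsetProd _ fun l _ => ?_).mul (continuous_const.mul ?_)
  · exact continuous_sp.comp ((continuous_const.mul (EuclideanSpace.proj l : E3 →L[ℝ] ℝ).continuous).sub
      continuous_const)
  · exact continuous_dsp.comp ((continuous_const.mul (EuclideanSpace.proj i : E3 →L[ℝ] ℝ).continuous).sub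
      continuous_const)

/-- `Dψ_a(x) = (amp_k Dφ_a(x) ·) e₀`. [folklore] -/
theorem hasFDerivAt_psi (a : Idx) (x : E3) :
    HasFDerivAt (psi a)
      ((amp a.1 • ∑ i, dtens a i x • (EuclideanSpace.proj i : E3 →L[ℝ] ℝ)).smulRight e0) x :=
  ((hasFDerivAt_tens a x).const_mul (amp a.1)).smul_const e0

/-- `Dψ_a(x) h = (amp_k Σᵢ ∂ᵢφ_a(x) hᵢ) e₀`. [folklore] -/
theorem fderiv_psi_apply (a : Idx) (x h : E3) :
    fderiv ℝ (psi a) x h = (amp a.1 * ∑ i, dtens a i x * h i) • e0 := by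
  rw [(hasFDerivAt_psi a x).fderiv, ContinuousLinearMap.smulRight_apply]
  simp [Finset.mul_sum]

/-- `ψ_a ∈ C¹(ℝ³; ℝ³)` (the structure's regularity field). [folklore] -/
theorem contDiff_psi (a : Idx) : ContDiff ℝ 1 (psi a) :=
  (contDiff_const.mul (contDiff_tens a)).smul contDiff_const

/-- `ψ_a` is continuous. [folklore] -/
theorem continuous_psi (a : Idx) : Continuous (psi a) := (contDiff_psi a).continuous

/-! #### pointwise formulas (tensor-product shape, ready for Fubini) -/

/-- `|ψ_a(x)|² = amp_k² ∏ᵢ sp(2^k xᵢ − jᵢ)²`. [folklore] -/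
theorem norm_psi_sq (a : Idx) (x : E3) :
    ‖psi a x‖ ^ 2 = amp a.1 ^ 2 * ∏ i, spS a.1 (a.2 i) (x i) ^ 2 := by
  rw [psi, norm_smul, norm_e0, mul_one, Real.norm_eq_abs, sq_abs, mul_pow, tens, Finset.prod_pow]

/-- `ψ_a(x)·ψ_b(x) = amp_a amp_b ∏ᵢ sp_a(xᵢ) sp_b(xᵢ)`. [folklore] -/
theorem inner_psi_psi (a b : Idx) (x : E3) :
    ⟪psi a x, psi b x⟫_ℝ = amp a.1 * amp b.1 * ∏ i, (spS a.1 (a.2 i) (x i) * spS b.1 (b.2 i) (x i)) := by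
  rw [psi, psi, real_inner_smul_left, real_inner_smul_right, inner_e0_e0, tens, tens,
    Finset.prod_mul_distrib]
  ring

/-- `(ψ_b·∇)ψ_a (x) = amp_a amp_b ∂₀φ_a(x) φ_b(x) e₀` (the fields point along `e₀`, so only `∂₀` enters).
[folklore] -/
theorem convect_psi (a b : Idx) (x : E3) :
    convect (psi b) (psi a) x = (amp a.1 * amp b.1 * (dtens a 0 x * tens b x)) • e0 := by
  rw [convect_apply, fderiv_psi_apply]
  congr 1
  simp [psi_apply]
  ring

/-- `ψ_a·(ψ_b·∇)ψ_a (x) = amp_a² amp_b φ_a(x) ∂₀φ_a(x) φ_b(x)`. [folklore] -/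
theorem inner_psi_convect (a b : Idx) (x : E3) :
    ⟪psi a x, convect (psi b) (psi a) x⟫_ℝ = amp a.1 ^ 2 * amp b.1 * (tens a x * dtens a 0 x * tens b x) := by
  rw [convect_psi, psi, real_inner_smul_left, real_inner_smul_right, inner_e0_e0]
  ring

/-- `|∇ψ_a(x)|² = amp_k² Σᵢ (∂ᵢφ_a(x))²` (Frobenius norm in the standard basis). [folklore] -/
theorem gradSq_psi (a : Idx) (x : E3) : gradSq (psi a) x = amp a.1 ^ 2 * ∑ i, dtens a i x ^ 2 := by
  unfold gradSq
  rw [frobeniusNormSq_eq_sum (EuclideanSpace.basisFun (Fin 3) ℝ)]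
  simp_rw [fderiv_psi_apply, norm_smul, norm_e0, mul_one, Real.norm_eq_abs, sq_abs]
  simp [EuclideanSpace.basisFun_apply, mul_pow, Finset.mul_sum]

/-- splitting a product over `Fin 3` at the index carrying the `if`. [folklore] -/
theorem prod_ite_eq_mul_prod_erase (i : Fin 3) (D S : Fin 3 → ℝ) :
    (∏ l, if l = i then D l else S l) = D i * ∏ l ∈ Finset.univ.erase i, S l := by
  rw [← Finset.mul_prod_erase Finset.univ _ (Finset.mem_univ i), if_pos rfl]
  congr 1
  exact Finset.prod_congr rfl fun l hl => if_neg (Finset.ne_of_mem_erase hl)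

/-- tensor shape of `φ_a ∂₀φ_a φ_b`: `2^k ∏_l F_l(x_l)` with `F_0 = sp_a sp′_a sp_b`, `F_l = sp_a² sp_b` (`l ≠ 0`).
[folklore] -/
theorem tens_dtens_tens (a b : Idx) (x : E3) :
    tens a x * dtens a 0 x * tens b x = 2 ^ a.1 * ∏ l, (if l = 0 then
      spS a.1 (a.2 l) (x l) * dspS a.1 (a.2 l) (x l) * spS b.1 (b.2 l) (x l)
      else spS a.1 (a.2 l) (x l) ^ 2 * spS b.1 (b.2 l) (x l)) := by
  rw [prod_ite_eq_mul_prod_erase 0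
      (fun l => spS a.1 (a.2 l) (x l) * dspS a.1 (a.2 l) (x l) * spS b.1 (b.2 l) (x l))
      (fun l => spS a.1 (a.2 l) (x l) ^ 2 * spS b.1 (b.2 l) (x l)),
    tens, tens, dtens,
    ← Finset.mul_prod_erase Finset.univ (fun l => spS a.1 (a.2 l) (x l)) (Finset.mem_univ 0),
    ← Finset.mul_prod_erase Finset.univ (fun l => spS b.1 (b.2 l) (x l)) (Finset.mem_univ 0),
    Finset.prod_mul_distrib, Finset.prod_pow]
  ring

/-- tensor shape of `(∂ᵢφ_a)²`: `4^k ∏_l G_l(x_l)` with `G_i = sp′_a²`, `G_l = sp_a²` (`l ≠ i`). [folklore] -/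
theorem dtens_sq (a : Idx) (i : Fin 3) (x : E3) :
    dtens a i x ^ 2 = 4 ^ a.1 * ∏ l, (if l = i then dspS a.1 (a.2 l) (x l) ^ 2
      else spS a.1 (a.2 l) (x l) ^ 2) := by
  have h4 : (4 : ℝ) ^ a.1 = (2 ^ a.1) ^ 2 := by
    rw [← pow_mul, mul_comm, pow_mul]
    norm_num
  rw [prod_ite_eq_mul_prod_erase i (fun l => dspS a.1 (a.2 l) (x l) ^ 2)
      (fun l => spS a.1 (a.2 l) (x l) ^ 2),
    dtens, h4, Finset.prod_pow]
  ring

end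

end Summit.NavierStokesRegularity.NavierStokesRegularity.Theorems.Haitani2025.B0

-- WHAT THIS IS NOT: not a claim about NS regularity or blow-up; not a claim about any author beyond the typed locator.
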